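import Mathlib
import HarnessLib
import Literature.MathematicalPhysics.StatisticalMechanics.RenormalisationMapCounting

/-!
# Regrouping the remainder sums of the renormalisation map ([ABKM19] Theorem 6.8 / Lemma 9.6)

Bookkeeping identities connecting the four remainder sums of `GradientRG.nextKStep_sub_opC_eq`
(RenormalisationMapRemainder) with the Lipschitz bounds landed for them
(RenormalisationMapRemainderTwoLarge / Three / Four):

* `polys_blockOf` — the sub-polymers of a single block are `∅` and the block; hence
  `polys_blockOf_erase_erase`: the index set `((𝓟_k(B)).erase B).erase ∅` of `rest(B)` is empty and the
  third piece `p_B · R[rest(B)]` of the block sum VANISHES (`sum_rest_blockOf_eq_zero`);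
* `sum_large_regroup` — the second remainder sum equals `Σ₂ᴸ − Σ_{X} R K(X)`:
  `Σ_X [(p_X − 1)RK(X) + p_X(RE(X) + Rr(X) + J(X))] = Σ_X p_X(RP(X) + J(X)) − Σ_X RK(X)` whenever
  `RP(X) = RK(X) + RE(X) + Rr(X)` (the split `R P₂ = RK + R(e^{−H}−1)^X + R rest`), i.e. the large part
  of the linearisation `C_kK(U)` is added back (its own bound is [ABKM19] Lemma 10.2).

Everything is proved; elementary.

## References
* S. Adams, S. Buchholz, R. Kotecký, S. Müller, arXiv:1910.13564, Theorem 6.8, Ch. 9.1, Ch. 10.1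
  [AdamsBuchholzKoteckyMuller2019].
-/

noncomputable section

namespace Literature.MathematicalPhysics.StatisticalMechanics.TorusPolymer

open scoped BigOperators Classical
open Finset

variable {d M : ℕ} [NeZero M]

/-- **The sub-polymers of a block**: `𝓟_k(B_x) = {∅, B_x}`. [cite: AdamsBuchholzKoteckyMuller2019, Ch. 6.2] -/
theorem polys_blockOf (s : ℕ) (x : Fin d → ZMod M) :
    polys s (blockOf s x) = {∅, blockOf s x} := by
  ext Y
  rw [mem_polys, mem_insert, mem_singleton]
  constructor
  · rintro ⟨hYB, hYp⟩
    rcases Y.eq_empty_or_nonempty with rfl | ⟨y, hy⟩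
    · exact Or.inl rfl
    · refine Or.inr (Subset.antisymm hYB ?_)
      have h := hYp y hy
      rw [blockOf_eq_of_mem (hYB hy)] at h
      exact h
  · rintro (rfl | rfl)
    · exact ⟨empty_subset _, isPolymer_empty s⟩
    · exact ⟨Subset.rfl, isPolymer_blockOf s x⟩

/-- The index set of `rest(B)` is empty for a block `B`: `((𝓟_k(B)).erase B).erase ∅ = ∅`.
[cite: AdamsBuchholzKoteckyMuller2019, Theorem 6.8 (no second-order polymer term inside one block)] -/
theorem polys_blockOf_erase_erase (s : ℕ) (x : Fin d → ZMod M) :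
    ((polys s (blockOf s x)).erase (blockOf s x)).erase ∅ = ∅ := by
  rw [polys_blockOf]
  ext Y
  simp only [mem_erase, mem_insert, mem_singleton, notMem_empty, iff_false, not_and]
  rintro hY0 hYB (rfl | rfl)
  · exact hY0 rfl
  · exact hYB rfl

/-- **`rest(B) = 0` on a block**: `Σ_{Y ∈ ((𝓟_k(B)).erase B).erase ∅} f(Y) = 0`.
[cite: AdamsBuchholzKoteckyMuller2019, Theorem 6.8] -/
theorem sum_rest_blockOf_eq_zero {β : Type*} [AddCommMonoid β] (s : ℕ) (x : Fin d → ZMod M)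
    (f : Finset (Fin d → ZMod M) → β) :
    ∑ Y ∈ ((polys s (blockOf s x)).erase (blockOf s x)).erase ∅, f Y = 0 := by
  rw [polys_blockOf_erase_erase, sum_empty]

omit [NeZero M] in
/-- **Regrouping the large connected preimages**: if `RP(X) = RK(X) + RE(X) + Rr(X)` on the index set,
then `Σ_X [(p_X − 1)RK(X) + p_X(RE(X) + Rr(X) + J(X))] = Σ_X p_X(RP(X) + J(X)) − Σ_X RK(X)` — the second
remainder sum is `Σ₂ᴸ` minus the large part of `C_kK`. [cite: AdamsBuchholzKoteckyMuller2019, Theorem 6.8 / Ch. 10.1 (10.2)] -/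
theorem sum_large_regroup {ι : Type*} (I : Finset ι) (p RK RE Rr J RP : ι → ℂ)
    (hsplit : ∀ X ∈ I, RP X = RK X + RE X + Rr X) :
    ∑ X ∈ I, ((p X - 1) * RK X + p X * (RE X + Rr X + J X)) =
      (∑ X ∈ I, p X * (RP X + J X)) - ∑ X ∈ I, RK X := by
  rw [← sum_sub_distrib]
  refine sum_congr rfl fun X hX => ?_
  rw [hsplit X hX]
  ring

end Literature.MathematicalPhysics.StatisticalMechanics.TorusPolymer

end
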